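/-
Origin: expansion seat `planner-pub-hodgecm-mc-axioms-1-g14-0`, handover #W89 2026-08-20T15:53:55Z md5 15792c644bbd (PKG f74efe105e3f → 15792c644bbd; 112 l.; MECHANICAL (iib-R) rewrite v3.1 of the PKG file as it stands (87 token edits; rules R1x1+RX[h₂]x86)) (`HOME/mc/pub-hodgecm-mc-axioms-1-g14/revendor/kit-r55/stage55/HodgeCM/Model/E2InstanceR5.lean`, md5 15792c644bbd, 112 lines);
landed by the gen-22 packager (p-g22) in gate run 55 REPLACES the earlier landed copy of `HodgeCM/Model/E2InstanceR5.lean` (seat copy carried the packager Origin header of an earlier run (stripped)).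
-/
/-
Origin: CONSTRUCTION seat `planner-pub-hodgecm-mc-glue-1-g3-0` (unit pub-hodgecm-mc-glue-1-g3, gen 3 of mc-glue-1,
node E ASSEMBLER), 2026-08-18.  NEW additive leaf `HodgeCM/Model/E2InstanceR5.lean` (imports `E2InstanceR4` +
`EmbInstance` (node E rev-3c (P)) + `CMInflationPrinted` (mc-axioms-1-g3, G0-(v5) rev 2)).  No proof holes; every
undischarged input is an explicit binder.  Expected `#print axioms`: {propext, Classical.choice, Quot.sound}.
-/
import Summits.HodgeConjecture.HodgeCM.Model.E2InstanceR4
import Summits.HodgeConjecture.HodgeCM.Model.EmbInstance_2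
import Summits.HodgeConjecture.HodgeCM.Model.CMInflationPrinted

/-!
# E2 instance, revision 5: `emb` CONSTRUCTED (rev-3c) and `h31` DISCHARGED (rev-3d)

`Model.perL_picardCM_r5` = `Model.perL_picardCM_r4` with

* the DATA binder `emb : ∀ {L ι₁ V} (Γ : Level V), U.CohC (U.pms L ι₁ V Γ) 2 →ₗ[ℂ] (V.latticeModel hP).toQuotientModel.H`
  REPLACED by the kernel TERM `Model.embOf hHD hI h₁ h₃` (`HodgeCM/Model/EmbInstance.lean`: top holomorphic
  form of a class on the real Hodge model → adelic lift to `L²([U(V)], regimeν)` through the uniformisation datum of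
  `X_Γ` (tree leaf `ShimuraVarieties/UnitaryBallAdelicLift`, vendored) → the PKG's isometric transport
  `regimeTransportL2`), so every later binder that mentions the theta model (`innerEmb`, `hLiu`, `ballFacts`,
  `classPacks`, `gen12`, `real34`, `occ`) is now ABOUT THIS CONCRETE `emb`;
* the binder `h31 : U.Fact_cmInflation` (M38, CM inflation) REPLACED by mc-axioms-1-g3's
  `Model.fact_cmInflation_printed hHD hI h₃ h₁ hd ha` (`HodgeCM/Model/CMInflationPrinted.lean`), which rests on
  the two inputs `hd : Shimura1998_Thm3_isogenousPower`, `ha : Shimura1998_Thm2_Cor`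
  (`Literature/AlgebraicGeometry/ComplexMultiplication/ShimuraInflation`, `ShimuraIsogeny`, vendored) — the
  Betti junctions `hb`, `hc` of rev 1 being kernel theorems of the tree (`ShimuraInflationBettiJunctions`).

Remaining binders: `hHR`, `h`, `hA`, `wm`, `Theta`, `d12`, `d34`, `innerEmb`, `hd`, `ha`, `hLiu`, `ball`,
`ballFacts`, `classPacks`, `gen12`, `real34`, `occ`.
-/

noncomputable section

open scoped TensorProduct InnerProductSpace

namespace HodgeCM

namespace Model

open HodgeCM.Universe (AdelicThetaCore AdelicThetaCore₀ SideData ThetaModel ModelAxiomsPerL)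
open Literature.AlgebraicGeometry.HodgeTheory
open Literature.AlgebraicGeometry.ComplexMultiplication (Shimura1998_Thm3_isogenousPower Shimura1998_Thm2_Cor)
open Literature.NumberTheory.Automorphic.PicardCM
open Literature.NumberTheory.Transcendental (Arapura2012_Cor_15_4_6)
open HodgeCM.CMTypeOps (inflate)
open HodgeCM.Model.SupplyInstance (LineSupplyData)
open HodgeCM.Model.SupplyResidual (ClassSupplyPack)

variable (hHD : exists_isReal_hodgeModel) (hI : hodgePQ_independent_of_hodgeModel)
  (h₁ : BallQuotientUniformised)  (h₃ : CMAbelianVarietyRealised)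

/-- **E2 instance, revision 5** (see the module docstring): `perL_picardCM_r4` at `emb := Model.embOf hHD hI h₁ h₃`
and `h31 := Model.fact_cmInflation_printed hHD hI h₃ h₁ hd ha`. -/
theorem perL_picardCM_r5 (hHR : BettiUniverse.HodgeRiemann20) (h : Bool)
    (hA : Arapura2012_Cor_15_4_6)
    (wm : ∀ {L : CMField} {ι₁ : L →+* ℂ} (V : HermSpace3 L ι₁) (c : SeesawCtx L),
      WeilThetaModel (V.latticeModel printFact_unitaryCompact_holds).toQuotientModel.G
        (V.latticeModel printFact_unitaryCompact_holds).toQuotientModel.Γ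
        (c.D.latticeModelW printFact_unitaryCompact_holds).toQuotientModel.G
        (c.D.latticeModelW printFact_unitaryCompact_holds).toQuotientModel.Γ)
    (Theta : ∀ {L : CMField} {ι₁ : L →+* ℂ} (V : HermSpace3 L ι₁), SeesawCtx L → Fin 4 → ∀ Γ : Level V,
      Set ((picardCMUniverse hHD hI h₁ h₃).CohC ((picardCMUniverse hHD hI h₁ h₃).pms L ι₁ V Γ) 1))
    (d12 d34 : ∀ {L : CMField}, SeesawCtx L → SideData L)
    (innerEmb : ∀ {L : CMField} {ι₁ : L →+* ℂ} (V : HermSpace3 L ι₁) (c : SeesawCtx L),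
      (thetaModelOf hHD hI h₁ h₃ h (embOf hHD hI h₁ h₃) (coverOf hHD hI h₁ h₃ hA) wm Theta d12 d34).GoodCtx ι₁ c → Module.finrank ℚ c.K = 6 →
      (thetaModelOf hHD hI h₁ h₃ h (embOf hHD hI h₁ h₃) (coverOf hHD hI h₁ h₃ hA) wm Theta d12 d34).InnerEmbAt V)
    (hd : Shimura1998_Thm3_isogenousPower) (ha : Shimura1998_Thm2_Cor)
    (hLiu : ∀ {L : CMField} {ι₁ : L →+* ℂ} (V : HermSpace3 L ι₁) (c : SeesawCtx L),
      (thetaModelOf hHD hI h₁ h₃ h (embOf hHD hI h₁ h₃) (coverOf hHD hI h₁ h₃ hA) wm Theta d12 d34).GoodCtx ι₁ c → Module.finrank ℚ c.K = 6 →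
      ∀ (i : Fin 4) (Γ : Level V), ∃ (M : CMField) (k : c.K →+* M) (σ' : M →+* ℂ), σ'.comp k = c.σ ∧
        (thetaModelOf hHD hI h₁ h₃ h (embOf hHD hI h₁ h₃) (coverOf hHD hI h₁ h₃ hA) wm Theta d12 d34).Theta V c i Γ ⊆
          (picardCMUniverse hHD hI h₁ h₃).Uiso Γ M (inflate k (c.Ψ i)) σ')
    (ball : ∀ {L : CMField} {ι₁ : L →+* ℂ} (V : HermSpace3 L ι₁) (c : SeesawCtx L),
      (picardCMUniverse hHD hI h₁ h₃).BallData V c)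
    (ballFacts : ∀ {L : CMField} {ι₁ : L →+* ℂ} (V : HermSpace3 L ι₁) (c : SeesawCtx L),
      (thetaModelOf hHD hI h₁ h₃ h (embOf hHD hI h₁ h₃) (coverOf hHD hI h₁ h₃ hA) wm Theta d12 d34).GoodCtx ι₁ c → Module.finrank ℚ c.K = 6 →
      (thetaModelOf hHD hI h₁ h₃ h (embOf hHD hI h₁ h₃) (coverOf hHD hI h₁ h₃ hA) wm Theta d12 d34).BallFacts V c (ball V c))
    (classPacks : ∀ {L : CMField} {ι₁ : L →+* ℂ} (V : HermSpace3 L ι₁) (c : SeesawCtx L),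
      (thetaModelOf hHD hI h₁ h₃ h (embOf hHD hI h₁ h₃) (coverOf hHD hI h₁ h₃ hA) wm Theta d12 d34).GoodCtx ι₁ c → Module.finrank ℚ c.K = 6 →
      Nonempty (ClassSupplyPack (thetaModelOf hHD hI h₁ h₃ h (embOf hHD hI h₁ h₃) (coverOf hHD hI h₁ h₃ hA) wm Theta d12 d34) V c 0) ∧
        Nonempty (ClassSupplyPack (thetaModelOf hHD hI h₁ h₃ h (embOf hHD hI h₁ h₃) (coverOf hHD hI h₁ h₃ hA) wm Theta d12 d34) V c 1))
    (gen12 : ∀ {L : CMField} {ι₁ : L →+* ℂ} (V : HermSpace3 L ι₁) (c : SeesawCtx L),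
      (thetaModelOf hHD hI h₁ h₃ h (embOf hHD hI h₁ h₃) (coverOf hHD hI h₁ h₃ hA) wm Theta d12 d34).GoodCtx ι₁ c → Module.finrank ℚ c.K = 6 →
      Nonempty ((thetaModelOf hHD hI h₁ h₃ h (embOf hHD hI h₁ h₃) (coverOf hHD hI h₁ h₃ hA) wm Theta d12 d34).Gen12FunBridge V c))
    (real34 : ∀ {L : CMField} {ι₁ : L →+* ℂ} (V : HermSpace3 L ι₁) (c : SeesawCtx L),
      (thetaModelOf hHD hI h₁ h₃ h (embOf hHD hI h₁ h₃) (coverOf hHD hI h₁ h₃ hA) wm Theta d12 d34).GoodCtx ι₁ c → Module.finrank ℚ c.K = 6 →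
      Nonempty ((thetaModelOf hHD hI h₁ h₃ h (embOf hHD hI h₁ h₃) (coverOf hHD hI h₁ h₃ hA) wm Theta d12 d34).Real34FunBridge V c))
    (occ : ∀ {L : CMField} {ι₁ : L →+* ℂ} (V : HermSpace3 L ι₁) (c : SeesawCtx L),
      (thetaModelOf hHD hI h₁ h₃ h (embOf hHD hI h₁ h₃) (coverOf hHD hI h₁ h₃ hA) wm Theta d12 d34).GoodCtx ι₁ c → Module.finrank ℚ c.K = 6 →
      (∀ (Φ : (thetaModelOf hHD hI h₁ h₃ h (embOf hHD hI h₁ h₃) (coverOf hHD hI h₁ h₃ hA) wm Theta d12 d34).SK V c)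
          (i : (thetaModelOf hHD hI h₁ h₃ h (embOf hHD hI h₁ h₃) (coverOf hHD hI h₁ h₃ hA) wm Theta d12 d34).SigIdx V c),
          (∃ v ∈ ((thetaModelOf hHD hI h₁ h₃ h (embOf hHD hI h₁ h₃) (coverOf hHD hI h₁ h₃ hA) wm Theta d12 d34).core V c).hatσ i,
              ((thetaModelOf hHD hI h₁ h₃ h (embOf hHD hI h₁ h₃) (coverOf hHD hI h₁ h₃ hA) wm Theta d12 d34).core V c).TΦ Φ v ≠ 0) →
          ((thetaModelOf hHD hI h₁ h₃ h (embOf hHD hI h₁ h₃) (coverOf hHD hI h₁ h₃ hA) wm Theta d12 d34).t12 V c).wOccurs i) ∧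
        (∀ (Φ : (thetaModelOf hHD hI h₁ h₃ h (embOf hHD hI h₁ h₃) (coverOf hHD hI h₁ h₃ hA) wm Theta d12 d34).SK V c)
          (i : (thetaModelOf hHD hI h₁ h₃ h (embOf hHD hI h₁ h₃) (coverOf hHD hI h₁ h₃ hA) wm Theta d12 d34).SigIdx V c),
          (∃ v ∈ ((thetaModelOf hHD hI h₁ h₃ h (embOf hHD hI h₁ h₃) (coverOf hHD hI h₁ h₃ hA) wm Theta d12 d34).core V c).hatσ i,
              ((thetaModelOf hHD hI h₁ h₃ h (embOf hHD hI h₁ h₃) (coverOf hHD hI h₁ h₃ hA) wm Theta d12 d34).core V c).TΦ Φ v ≠ 0) →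
          ((thetaModelOf hHD hI h₁ h₃ h (embOf hHD hI h₁ h₃) (coverOf hHD hI h₁ h₃ hA) wm Theta d12 d34).t34 V c).wOccurs i)) :
    (picardCMUniverse hHD hI h₁ h₃).PerL :=
  perL_picardCM_r4 hHD hI h₁ h₃ hHR h (embOf hHD hI h₁ h₃) hA wm Theta d12 d34 innerEmb
    (fact_cmInflation_printed hHD hI h₃ h₁ hd ha) hLiu ball ballFacts classPacks gen12 real34 occ

end Model

end HodgeCM

end
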